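import Mathlib
import Literature.Analysis.FluidPDE.GaussianVortexKernelRadial
import HarnessLib

/-!
# ArnoldCoercivityGaussianVortex

Topic `Literature/Analysis/FluidPDE`. Named literature fact(s) relocated by the gate from `Summits/NavierStokesRegularity/NavierStokesRegularity/Theorems/FilamentSkeletonRssCoreLinearInvertibilityOddArnoldCore.lean`
(accept-time relocation of `[cite]`d propositions written inline in a Summits proposal; human ruling 2026-08-15).
Sources: GallaySverak2021.

* `Literature.Analysis.FluidPDE.GallaySverak2021_thm25_gaussian`
-/

namespace Literature.Analysis.FluidPDE

open Set Function Filter MeasureTheory Topology Metric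
open Literature.Analysis.FluidPDE
open scoped InnerProductSpace

/-- **Gallay–Šverák, Theorem 2.5 with Remark 2.7, at the Gaussian (Lamb–Oseen) vortex: coercivity of
Arnold's quadratic form `J` on non-radial densities with vanishing first moments.**
Setting (arXiv:2110.13739, §2): a radially symmetric vortex `ω̄(x) = ω_*(|x|)`, `ω_* ∈ C²([0,∞))`,
with `ω_*(0) > 0`, `ω_*'(0) = 0`, `ω_*''(0) < 0`, `ω_*'(r) < 0` for `r > 0`, `ω_*(r) → 0`,
`|ω_*'(r)| ≤ C(1+r)^{−β−1}` for some `β > 2` (Hypotheses 2.1); `ψ_*'(r) = r⁻¹∫₀ʳ s ω_*(s) ds`;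
the weight `A(r) = −ψ_*'(r)/ω_*'(r)`, `𝒜(x) = A(|x|)`; `X = {ω ∈ L²(ℝ²) : ‖ω‖²_X = ∫ 𝒜 ω² < ∞}`
(`↪ L¹`), `X₀ = {ω ∈ X : ∫ ω = 0}`, `X₁ = {ω ∈ X₀ : ∫ (x_j/|x|) ω = 0, j = 1,2}`, `X_rs` the radially
symmetric elements of `X` and `X_rs^⊥` its orthogonal complement in `X`; Arnold's form
`J(ω) = ½ ∫ 𝒜 ω² + (1/4π) ∫∫ log|x−y| ω(x) ω(y) dx dy`, `ω ∈ X` (`= ½‖ω‖²_X − E(ω)`,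
`E(ω) = −½ ∫ ψ ω`, `ψ(x) = (2π)⁻¹ ∫ log|x−y| ω(y) dy`, §1.2 (iv); well defined on `X`, Prop. 2.2).
*"Theorem 2.5. Under Hypotheses 2.1, the quadratic form `J` defined by [the display above] is
nonnegative on the space `X_rs^⊥ ⊂ X₀`. Moreover, there exists a constant `γ > 0` such that
`J(ω) ≥ (γ/2) ∫ 𝒜(x) ω(x)² dx` for all `ω ∈ X_rs^⊥ ∩ X₁`."* — *"Remark 2.7. If `β > 4` in
Hypotheses 2.1, the conclusion of Theorem 2.5 remains valid, with the same proof, if the subspace `X₁`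
is replaced by `𝒳₁ = {ω ∈ X₀ : ∫ x_j ω(x) dx = 0 for j = 1,2}`. This possibility will be used in
Section 4."* Section 4 takes `ω̄ = G = (4π)⁻¹ e^{−|x|²/4}` (the Gaussian satisfies Hypotheses 2.1 with
every `β`), for which *"`𝒜(x) = 4|x|⁻²(e^{|x|²/4} − 1)`"* (Lemma 4.1), i.e. `A(r) = (eˢ − 1)/s`,
`s = r²/4` (§4.2) — in the tree `𝒜 = 1/Φ`, `Φ = kerWeight`, `Φ(r) = (r²/4)/(e^{r²/4} − 1)`
(`kerWeight_eq`) — and records (proof of Thm. 4.5) *"by Theorems 2.5 and 2.8, there exists a constant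
`γ ∈ (0,1)` such that `(γ/2) m₀(t) ≤ J̃(t)`"*, `m₀ = ‖ω̃‖²_X`, for `ω̃ ∈ 𝒳₁`.
VENDORED as the specialisation to the Gaussian weight `𝒜 = Φ⁻¹` and to CONTINUOUS, ODD
(`ω(−x) = −ω(x)`, so `ω ⊥ X_rs` in `X` and `∫ ω = 0`, i.e. `ω ∈ X_rs^⊥ ⊆ X₀`) densities of GAUSSIAN
CLASS (`|ω(x)| ≤ C(1+|x|)^N e^{−|x|²/4}`, so `ω ∈ X` as `Φ⁻¹ ≤ e^{|x|²/4}`, and the double integral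
converges absolutely — by Fubini it is the iterated integral `2π ∫ ω ψ_ω` written below) satisfying
the first-moment conditions of Remark 2.7 (`∫ x_j ω = 0`; Lean indices `0, 1`), the inequality
multiplied by `2`: `γ ∫ Φ⁻¹ ω² ≤ ∫ Φ⁻¹ ω² + ∫ ω ψ_ω` with `ψ_ω(x) = ∫ (2π)⁻¹ log‖x − y‖ ω(y) dy`.
Hypotheses strengthened (a subclass of `X_rs^⊥ ∩ 𝒳₁`), conclusion as printed.
[cite: GallaySverak2021, Thm. 2.5 with Rem. 2.7; §4.1 Lemma 4.1 (the Gaussian weight)]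
[file Analysis/FluidPDE/ArnoldCoercivityGaussianVortex] -/
def GallaySverak2021_thm25_gaussian : Prop :=
  ∃ γ : ℝ, 0 < γ ∧ ∀ ω : EuclideanSpace ℝ (Fin 2) → ℝ, Continuous ω →
    (∃ (C : ℝ) (N : ℕ), ∀ x, |ω x| ≤ C * (1 + ‖x‖) ^ N * Real.exp (-(‖x‖ ^ 2 / 4))) →
    (∀ x, ω (-x) = -ω x) → ∫ x, x 0 * ω x = 0 → ∫ x, x 1 * ω x = 0 →
    γ * ∫ x, (kerWeight ‖x‖)⁻¹ * ω x ^ 2 ≤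
      (∫ x, (kerWeight ‖x‖)⁻¹ * ω x ^ 2) +
        ∫ x, ω x * ∫ y, (2 * Real.pi)⁻¹ * Real.log ‖x - y‖ * ω y

end Literature.Analysis.FluidPDE
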